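import Summits.MatrixMultiplication.MatrixMultiplication.Theses.AlgebraicSTPPDichotomy
import Literature.Computability.AlgebraicComplexity.STPPLineFamilies

/-!
# Refutation of `AlgebraicSTPPDichotomy.ExactLineDesign` (stmt-MatrixMultiplication-9732)

`ExactLineDesign` asks for a rank `m` such that for every `δ > 0` and arbitrarily large finite
fields `F` there are `N ≥ |F|^{m−2−δ}` triples of punctured lines `(F^× aᵢ, F^× bᵢ, F^× cᵢ)` in
`F^m` forming an STPP family (packing allows `N ≲ q^{m−2}`, `q = |F|`).  It is FALSE for every `m`:
by `Literature.Computability.AlgebraicComplexity.IsSTPP.lineFamily_card_bound` every such family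
has `N (q − 1)² (q + 1) + 7 < 7 q^m`, i.e. `N < 8 q^{m−3}` for large `q` — a full factor `q` below
packing — so `N ≥ q^{m−5/2}` fails as soon as `√q ≥ 28`.  (Mechanism: the STPP condition says the
three colour cones `⋃(Aᵢ − Bᵢ)`, `⋃(Bⱼ − Cⱼ)`, `⋃(C_k − A_k)` admit no zero sum off the diagonal;
since they are unions of punctured LINES, three distinct collinear projective points, one in each,
rescale to a zero sum, so every projective line is poor in one of the three projectivised cones,
while a second-moment count over the lines of `PG(m−1, q)` shows that three point sets of density
`≥ 7/(q+1)` always have a line rich in all three.)  The same count, run type by type on frames of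
equal dimensions and combined with packing on unbalanced types, proves `FrameBarrier` (the negation
of the route's target `ExactFrameDesign`); see the refuter's evidence on stmt-7620/9721.
-/

open Literature.Computability.AlgebraicComplexity

namespace Summit.MatrixMultiplication.MatrixMultiplication.Theorems

/-- Refutes `AlgebraicSTPPDichotomy.ExactLineDesign` [refuted-substantive]
(stmt-MatrixMultiplication-9732): for EVERY rank `m`, every STPP family of `N` triples of
punctured lines in `F_q^m` (`q ≥ 3`) has `N (q−1)²(q+1) + 7 < 7 q^m` (`IsSTPP.lineFamily_card_bound`:
line lemma on the three colour cones + second moment over the lines of `PG(m−1,q)`), so with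
`δ = 1/2`, `q₀ = 784` the required `N ≥ q^{m−2−δ} = q^{m−5/2}` gives `q^m √q ≤ N q³ < 28 q^m`,
i.e. `√q < 28`, contradicting `q ≥ 784`.  Witness of falsity: none needed (universal bound); the
design loses a full power `q^{1−o(1)}` against packing in every rank.  No cheap repair: (i) raising
`m` or restricting to prime fields changes nothing (the bound is uniform in `m` and in the field);
(ii) allowing frames of higher dimension `d` (the parent target `ExactFrameDesign`) is killed by the
same count type by type (`N_d < 7(q^m−1)/((q+1)(q^d−1)²)` for balanced types, packing for the
others) — FrameBarrier holds; (iii) weakening `N ≥ q^{m−2−δ}` to `N ≥ c·q^{m−3}` would survive but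
certifies only `ω ≤ 3 − O(1/m)`-type bounds, never `ω = 2` (it is below the `(2+ε)/3` threshold of
CKSU Thm 5.5 by a power).  Only NON-CONE designs (general definable sets: tori, CKSU §7 local
designs — crux `DefinableDesignBarrier`) escape the line lemma.
barrier-candidate: bounded-rank CONE barrier — in `F_q^m` (m fixed, q → ∞) STPP families whose sets
are punctured subspaces of equal dimension `d` have at most `7(q^m−1)/((q+1)(q^d−1)²)` blocks, a
factor `(q+1)/7` below packing, hence certify no `ω < 2 + 1/d` via CKSU (1.1). [folklore] -/
theorem AlgebraicSTPPDichotomyExactLineDesign_refuted :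
    ¬ Summit.MatrixMultiplication.MatrixMultiplication.Theses.AlgebraicSTPPDichotomy.ExactLineDesign := by
  rintro ⟨m, hm⟩
  obtain ⟨F, _instF, _instFin, hq0, N, a, b, c, A, B, C, hne, hA, hB, hC, hS, hN⟩ :=
    hm (1 / 2) (by norm_num) 784
  have hq3 : 3 ≤ Fintype.card F := le_trans (by norm_num) hq0
  have h1q : 1 ≤ Fintype.card F := le_trans (by norm_num) hq0
  have hqpos : (0 : ℝ) < Fintype.card F := by exact_mod_cast (lt_of_lt_of_le (by norm_num) hq0)
  -- `N = 0` is impossible (`q^{m - 5/2} > 0`)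
  rcases Nat.eq_zero_or_pos N with hN0 | hNpos
  · subst hN0
    have : (0 : ℝ) < (Fintype.card F : ℝ) ^ ((m : ℝ) - 2 - 1 / 2) := Real.rpow_pos_of_pos hqpos _
    simp only [Nat.cast_zero] at hN
    linarith
  -- hence `m ≥ 3`, and the count bound applies
  have hm3 : 3 ≤ m := hS.three_le_of_lineFamily hq3 hNpos a b c hne hA hB hC
  have hmain := hS.lineFamily_card_bound hq3 (by omega) a b c hne hA hB hC
  -- real arithmetic: `N q³/4 ≤ N (q-1)²(q+1) < 7 q^m` and `q^m √q = q^{m-5/2} q³ ≤ N q³`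
  set q : ℕ := Fintype.card F with hq
  have hnumR : (N : ℝ) * (((q : ℝ) - 1) ^ 2 * ((q : ℝ) + 1)) < 7 * (q : ℝ) ^ m := by
    have := (Nat.cast_lt (α := ℝ)).2 hmain
    push_cast [Nat.cast_sub h1q] at this
    nlinarith [this]
  have hq2 : (2 : ℝ) ≤ q := by exact_mod_cast (le_trans (by norm_num) hq0)
  have hlow : (q : ℝ) ^ 3 / 4 ≤ ((q : ℝ) - 1) ^ 2 * ((q : ℝ) + 1) := by nlinarith
  have hN0r : (0 : ℝ) ≤ N := Nat.cast_nonneg _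
  have h28 : (N : ℝ) * (q : ℝ) ^ 3 < 28 * (q : ℝ) ^ m := by nlinarith
  have e1 : (q : ℝ) ^ ((m : ℝ) - 2 - 1 / 2) * (q : ℝ) ^ 3 = (q : ℝ) ^ m * Real.sqrt q := by
    rw [← Real.rpow_natCast (q : ℝ) 3, ← Real.rpow_add hqpos, Real.sqrt_eq_rpow,
      ← Real.rpow_natCast (q : ℝ) m, ← Real.rpow_add hqpos]
    norm_num
    ring_nf
  have hsq : Real.sqrt q < 28 := by
    have h1 : (q : ℝ) ^ m * Real.sqrt q ≤ (N : ℝ) * (q : ℝ) ^ 3 := by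
      rw [← e1]
      exact mul_le_mul_of_nonneg_right hN (by positivity)
    have h2 : (q : ℝ) ^ m * Real.sqrt q < (q : ℝ) ^ m * 28 := by linarith
    exact lt_of_mul_lt_mul_left h2 (by positivity)
  have hge : (28 : ℝ) ≤ Real.sqrt q := by
    have h784 : ((28 : ℝ) ^ 2) ≤ q := by exact_mod_cast (show 784 ≤ q from hq0)
    calc (28 : ℝ) = Real.sqrt ((28 : ℝ) ^ 2) := by rw [Real.sqrt_sq (by norm_num)]
      _ ≤ Real.sqrt q := Real.sqrt_le_sqrt h784
  linarith

end Summit.MatrixMultiplication.MatrixMultiplication.Theorems
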